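import Literature.IUT.HodgeTheaters.PuncturedEllipticArrowModelUnorientedDatum
import Literature.IUT.HodgeTheaters.PuncturedEllipticArrowModelModLCuspLaws
import Literature.IUT.HodgeTheaters.PuncturedEllipticCoveringsArrowClaimsOfModLCuspLaws
import HarnessLib

/-!
# NV: the `Δ_ε`-level laws `ModLCuspLaws` HOLD at the UNORIENTED §1 model `ArrowModel.udatum` too

[IUTchI] §1 pp. 37–38 [cite: Mochizuki2012, IUTchI §1 pp.37-38] (D-0012 claim key, status disputed).  PROOF-ONLY
NON-VACUITY companion of `PuncturedEllipticCoveringsModLCuspLaws.lean` (p446054) at abc-iut-L5-t1 gen 4's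
UNORIENTED variant `ArrowModel.udatum l h5 h6` (p437242: the same `Π_C = N ⋊ D_l`, `N = ℤ/l × (ℤ/l)^{ℤ/l}`,
cusps `ℤ/l`, `G_k = 1`, but decomposition groups `D′_i = ⟨ĉ′_i⟩`, `ĉ′_i = (0, δ_i + δ_{i+1})` instead of
`(0, δ_{i+1} − δ_i)`).  Cell abc-iut, seat abc-iut-L5-t1 (gen 6); closes referee finding G32-F1 (ii)
(ref/REFEREE-PASS-G32.md §A.1: the header of p446054 asserts «the unoriented variant `udatum` does too» — this
file is its kernel witness).  Sequel of `PuncturedEllipticArrowModelModLCuspLaws.lean` (p448735, the oriented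
`datum`).  No `def`, no instance, no notation.

WHAT IS PROVED: `ArrowModel.modLCuspLaws_udatum (h5 : 5 ≤ l) (h6 : Nat.Coprime l 6) :
(udatum l h5 h6).ModLCuspLaws` — all six laws, every admissible `l` (symbolic):
* (L0) `Ker(Δ_X̲ ↠ Δ_X̲^{ab} ⊗ ℤ/l) = 1` has finite index `|N|` (as for `datum`);
* (L1) `D′_i = ⟨ĉ′_i⟩` is cyclic;
* (L2a) the image of `D′_1` in `N / ⨆_{i ∉ {0,±1}} D′_i` has order `l` — detected by the SAME coordinate
  `ℓ(A, f) = f(0) − f(1)` as in the oriented case, now with `ℓ(ĉ′_1) = −1` (`ell_uvec_one`) and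
  `⨆_{i ∉ {0,±1}} D′_i ⊆ K = Ker ℓ` (`EpsSupU_le_Khat`);
* (L2c) `D′_1 ∩ (D′_{−1} · ⨆_{i ∉ {0,±1}} D′_i) ⊆ ⨆_{i ∉ {0,±1}} D′_i` (indeed `= 1`) — detected by the coordinate
  `f ↦ f(1)`, which kills `ĉ′_i` for `i ∉ {0, 1}` (support `{i, i+1}`) and is `+1` at `ĉ′_1`;
* (L3) for `ι̲ ∈ Π_C̲ ∖ N` (so `ι̲ = (u, σ_0)`) and `v = (w, 1) ∈ N`: `ι̲ v ι̲⁻¹ · v = (σ_0 w + w, 1)` lies in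
  `S := D′_1 · D′_{−1} · ⨆_{i ∉ {0,±1}} D′_i = ⨆_{i ≠ 0} D′_i`.  NEW POINT versus the oriented case: `S` is now a
  PROPER subgroup of `{0} × (ℤ/l)^{ℤ/l}` (`ĉ′_0 ∉ S`: no cusp relation `Σ_i ĉ′_i = 0` holds), so the oriented
  argument "every `(0, δ_a − δ_b)` is a sum of cusp vectors" is unavailable; instead, STRUCTURALLY: the set of
  `(w, 1)` with `(σ_0 w + w, 1) ∈ S` is a subgroup (`N` abelian) containing every `ĉ′_j`, `j ≠ 0`
  (`σ_0 ĉ′_j = −ĉ′_{−j}`, `refl_uvec`), and every commutator `(w − σ_0 w, 1)` (`σ_0² = 1` gives `0`), hence all of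
  `N = D′_1 · K = D′_1 · (⨆_{i ∉ {0,±1}} D′_i) · ⟨commutators⟩` (`Du_one_sup_Khat`, `supU_closure_commSet_eq_Khat`);
* (L4) `N` is abelian.
Together with `udatumCuspGalois` (p437242) and `CuspGalois.arrowCoveringClaims_of_modLCuspLaws` (p448117) this
RE-DERIVES `ArrowCoveringClaims (udatum l h5 h6)` along the «hA re-grounding» route
(`udatum_arrowCoveringClaims_of_laws`; cf. the direct proof `udatum_arrowCoveringClaims`): the laws (L0)–(L4) do
not see the orientation of the zero cusp, in accordance with G-L5d4g6-1 (the `ε⁰`-ramification clause is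
independent of them, p437242/p438104).

HONEST FRAMING: a finite toy instance; nothing here asserts abc proved or refuted or takes a side on [IUTchIII]
Cor. 3.12; inhabited ≠ discharged at the genuine datum.
-/

namespace Literature.IUT.HodgeTheaters

namespace PuncturedEllipticData

namespace ArrowModel

open Literature.AnabelianGeometry.AbsoluteAnabelian DihedralGroup
open scoped Pointwise

variable {l : ℕ}

/-! ### Unoriented cusp vectors and the join `S = ⨆_{i ≠ 0} D′_i` -/

/-- `ĉ′_i ∈ D′_i`. [claim: Mochizuki2012, status: disputed] -/
theorem uhat_mem_Du (i : ZMod l) : uhat l i ∈ Du l i := by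
  unfold Du; exact Subgroup.mem_zpowers _

/-- For `j ≠ 0`: `D′_j ≤ D′_1 · D′_{−1} · ⨆_{i ∉ {0,±1}} D′_i`. [claim: Mochizuki2012, status: disputed] -/
theorem Du_le_supU_of_ne_zero {j : ZMod l} (hj : j ≠ 0) : Du l j ≤ Du l 1 ⊔ Du l (-1) ⊔ EpsSupU l := by
  by_cases h1 : j = 1
  · rw [h1]; exact le_sup_left.trans le_sup_left
  by_cases h2 : j = -1
  · rw [h2]; exact le_sup_right.trans le_sup_left
  have h : Du l j ≤ EpsSupU l :=
    le_iSup (fun x : {x : ZMod l // x ≠ 0 ∧ x ≠ 1 ∧ x ≠ -1} => Du l x.1) ⟨j, hj, h1, h2⟩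
  exact h.trans le_sup_right

/-! ### The laws, at the level of the finite group `N ⋊ D_l` -/

/-- (L2a) at the unoriented model: the image of `D′_1 = ⟨ĉ′_1⟩` in `N / ⨆_{i ∉ {0,±1}} D′_i` has order `l`
(coordinate `ℓ`, `ℓ(ĉ′_1) = −1`). [claim: Mochizuki2012, status: disputed] -/
theorem relIndex_EpsSupU_Du_one_sup [NeZero l] (h3 : 3 ≤ l) :
    (EpsSupU l).relIndex (Du l 1 ⊔ EpsSupU l) = l := by
  have hA : Du l 1 ⊔ EpsSupU l ≤ Nhat l :=
    sup_le (Du_le_Nhat l 1) ((EpsSupU_le_Khat l).trans (Khat_le_Nhat l))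
  have hnorm : ((EpsSupU l).subgroupOf (Du l 1 ⊔ EpsSupU l)).Normal :=
    normal_subgroupOf_of_commutator_le le_sup_right
      (((Subgroup.commutator_mono hA hA).trans (le_of_eq (commutator_Nhat_eq_bot l))).trans bot_le)
  refine relIndex_eq_of_le_zpowers_sup le_sup_right hnorm (Subgroup.mem_sup_left (uhat_mem_Du 1))
    (by unfold Du; exact le_rfl) ?_ ?_
  · unfold uhat; rw [← inN_nsmul, l_nsmul_eq_zero, inN_zero]; exact Subgroup.one_mem _
  · intro d hd
    have hK := EpsSupU_le_Khat l hd
    unfold uhat at hK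
    rw [← inN_nsmul, inN_mem_Khat_iff, map_nsmul, ell_uvec_one l h3, nsmul_eq_mul, mul_neg, mul_one,
      neg_eq_zero] at hK
    exact (ZMod.natCast_eq_zero_iff d l).mp hK

/-- (L2c) at the unoriented model: `D′_1 ∩ (D′_{−1} · ⨆_{i ∉ {0,±1}} D′_i) ⊆ ⨆_{i ∉ {0,±1}} D′_i` (indeed `= 1`),
detected by the coordinate `f ↦ f(1)` (it kills `ĉ′_i` for `i ∉ {0, 1}` and is `1` at `ĉ′_1`).
[claim: Mochizuki2012, status: disputed] -/
theorem Du_one_inf_sup_le (h5 : 5 ≤ l) : Du l 1 ⊓ (Du l (-1) ⊔ EpsSupU l) ≤ EpsSupU l := by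
  haveI : NeZero l := ⟨by omega⟩
  obtain ⟨-, cm10, c1m1, -, c21, -⟩ := cusp_facts_of_five_le l h5
  -- the subgroup `T = {(v, 1) : v.2 1 = 0}`
  let T : Subgroup (G l) :=
    { carrier := {g | g.right = 1 ∧ (Multiplicative.toAdd g.left).2 1 = 0}
      mul_mem' := by
        rintro g h ⟨hg1, hg2⟩ ⟨hh1, hh2⟩
        refine ⟨by rw [SemidirectProduct.mul_right, hg1, hh1, mul_one], ?_⟩
        rw [SemidirectProduct.mul_left, hg1, map_one, MulAut.one_apply, toAdd_mul, Prod.snd_add,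
          Pi.add_apply, hg2, hh2, add_zero]
      one_mem' := ⟨rfl, by simp⟩
      inv_mem' := by
        rintro g ⟨hg1, hg2⟩
        refine ⟨by rw [SemidirectProduct.inv_right, hg1, inv_one], ?_⟩
        rw [SemidirectProduct.inv_left, hg1, inv_one, map_one, MulAut.one_apply, toAdd_inv, Prod.snd_neg,
          Pi.neg_apply, hg2, neg_zero] }
  have huhatT : ∀ i : ZMod l, i ≠ 0 → i ≠ 1 → uhat l i ∈ T := by
    intro i hi0 hi1
    refine ⟨rfl, ?_⟩
    change (Multiplicative.toAdd (Multiplicative.ofAdd (uvec l i))).2 1 = 0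
    rw [toAdd_ofAdd]
    simp only [uvec, Pi.add_apply, δ_apply]
    have h1 : ¬ ((1 : ZMod l) = i) := fun h => hi1 h.symm
    have h2 : ¬ ((1 : ZMod l) = i + 1) := fun h => hi0 (by simpa using h.symm)
    rw [if_neg h1, if_neg h2, add_zero]
  have hle : Du l (-1) ⊔ EpsSupU l ≤ T := by
    refine sup_le ?_ (iSup_le fun x => ?_)
    · unfold Du; rw [Subgroup.zpowers_le]; exact huhatT (-1) cm10 (fun h => c1m1 h.symm)
    · unfold Du; rw [Subgroup.zpowers_le]; exact huhatT x.1 x.2.1 x.2.2.1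
  rintro g ⟨hg1, hg2⟩
  have hg1' : g ∈ Subgroup.zpowers (uhat l 1) := hg1
  obtain ⟨k, rfl⟩ := Subgroup.mem_zpowers_iff.mp hg1'
  obtain ⟨-, hk⟩ := hle hg2
  unfold uhat at hk ⊢
  rw [← inN_zsmul] at hk ⊢
  change (Multiplicative.toAdd (Multiplicative.ofAdd (k • uvec l 1))).2 1 = 0 at hk
  rw [toAdd_ofAdd, Prod.smul_snd, Pi.smul_apply] at hk
  have h21 : ((uvec l 1).2 : ZMod l → ZMod l) 1 = 1 := by
    simp only [uvec, Pi.add_apply, δ_apply, if_true]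
    rw [if_neg (fun h => c21 (by rw [h]; norm_num)), add_zero]
  rw [h21, zsmul_eq_mul, mul_one] at hk
  have hk0 : k • uvec l 1 = 0 := by
    rw [← Int.cast_smul_eq_zsmul (ZMod l) k (uvec l 1), hk, zero_smul]
  rw [hk0, inN_zero]
  exact Subgroup.one_mem _

/-- For `ι̲ = (u, σ_0)` and `w ∈ N`: `ι̲ (w,1) ι̲⁻¹ · (w,1) = (σ_0 w + w, 1)`. [claim: Mochizuki2012, status: disputed] -/
theorem conj_mul_self_eq_inN {c : G l} (hcr : c.right = sr 0) (w : V l) :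
    c * inN l w * c⁻¹ * inN l w = inN l (refl l 0 w + w) := by
  rw [conj_inN, hcr, dact_sr, ← inN_add]

/-- `σ_0` is an involution on `N`. [claim: Mochizuki2012, status: disputed] -/
theorem refl_zero_refl_zero (w : V l) : refl l 0 (refl l 0 w) = w := by
  ext m
  · simp
  · simp [sub_sub_cancel]

/-- (L3) at the unoriented model: for `ι̲ ∈ Π_C̲ ∖ N` and `v ∈ N`, `ι̲ v ι̲⁻¹ · v ∈ D′_1 · D′_{−1} · ⨆_{i ∉ {0,±1}} D′_i`
("`ι` acts on `Δ_E ⊗ ℤ/l` via `−1`") — structurally: the `v = (w,1)` with `(σ_0 w + w, 1)` in that join form a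
subgroup containing every `ĉ′_j`, `j ≠ 0`, and every commutator, hence all of `N = D′_1 · K`.
[claim: Mochizuki2012, status: disputed] -/
theorem conj_mul_self_mem_supU [NeZero l] (h3 : 3 ≤ l) {q : ℕ} (hq : l = 2 * q + 1) {c : G l}
    (hc : c ∈ PiCbarm l) (hcX : c ∉ Nhat l) {v : G l} (hv : v ∈ Nhat l) :
    c * v * c⁻¹ * v ∈ Du l 1 ⊔ Du l (-1) ⊔ EpsSupU l := by
  set S := Du l 1 ⊔ Du l (-1) ⊔ EpsSupU l with hS
  have hcr : c.right = sr 0 := by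
    rcases (mem_PiCbarm_iff l c).mp hc with h | h
    · exact absurd ((mem_Nhat_iff l c).mpr h) hcX
    · exact h
  -- the subgroup `M = {(w, 1) : (σ_0 w + w, 1) ∈ S}` of `N`
  let M : Subgroup (G l) :=
    { carrier := {g | ∃ w : V l, g = inN l w ∧ inN l (refl l 0 w + w) ∈ S}
      mul_mem' := by
        rintro g h ⟨a, rfl, ha⟩ ⟨b, rfl, hb⟩
        refine ⟨a + b, (inN_add l a b).symm, ?_⟩
        rw [map_add, show refl l 0 a + refl l 0 b + (a + b) = (refl l 0 a + a) + (refl l 0 b + b) by abel,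
          inN_add]
        exact S.mul_mem ha hb
      one_mem' := ⟨0, (inN_zero l).symm, by rw [map_zero, add_zero, inN_zero]; exact S.one_mem⟩
      inv_mem' := by
        rintro g ⟨a, rfl, ha⟩
        refine ⟨-a, (inN_neg l a).symm, ?_⟩
        rw [map_neg, ← neg_add, inN_neg]
        exact S.inv_mem ha }
  -- generators: `ĉ′_j ∈ M` for `j ≠ 0`
  have hDu : ∀ j : ZMod l, j ≠ 0 → Du l j ≤ M := by
    intro j hj
    unfold Du
    rw [Subgroup.zpowers_le]
    refine ⟨uvec l j, rfl, ?_⟩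
    rw [refl_uvec, neg_zero, zero_sub, inN_add, inN_neg]
    exact S.mul_mem (S.inv_mem (Du_le_supU_of_ne_zero (neg_ne_zero.mpr hj) (uhat_mem_Du (-j))))
      (Du_le_supU_of_ne_zero hj (uhat_mem_Du j))
  -- generators: commutators `(w − σ_0 w, 1) ∈ M`
  have hcomm : Subgroup.closure (commSet l) ≤ M := by
    rw [Subgroup.closure_le]
    intro z hz
    obtain ⟨w, rfl⟩ := exists_eq_inN_sub_refl_of_mem_commSet l hz
    refine ⟨w - refl l 0 w, rfl, ?_⟩
    rw [map_sub, refl_zero_refl_zero,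
      show refl l 0 w - w + (w - refl l 0 w) = 0 by abel, inN_zero]
    exact S.one_mem
  -- hence `N = D′_1 · (⨆ D′_x) · ⟨commutators⟩ ≤ M`
  have hN : Nhat l ≤ M := by
    have h10 : (1 : ZMod l) ≠ 0 := by
      exact_mod_cast natCast_ne_zero_of_lt l (a := 1) one_pos (by omega)
    rw [← Du_one_sup_Khat l h3, ← supU_closure_commSet_eq_Khat l hq h3]
    exact sup_le (hDu 1 h10) (sup_le (iSup_le fun x => hDu x.1 x.2.1) hcomm)
  obtain ⟨w, rfl, hw⟩ := hN hv
  rw [conj_mul_self_eq_inN hcr]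
  exact hw

/-- (L4) at the unoriented model: `N` is abelian. [claim: Mochizuki2012, status: disputed] -/
theorem conj_mul_inv_eq_one_of_mem_Du {g z : G l} (hg : g ∈ Nhat l) {x : ZMod l} (hz : z ∈ Du l x) :
    g * z * g⁻¹ * z⁻¹ = 1 := by
  have h : g * z * g⁻¹ * z⁻¹ ∈ ⁅Nhat l, Nhat l⁆ := by
    rw [← commutatorElement_def]; exact Subgroup.commutator_mem_commutator hg (Du_le_Nhat l x hz)
  rw [commutator_Nhat_eq_bot] at h
  exact Subgroup.mem_bot.mp h

/-! ### The laws at the unoriented model datum -/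

/-- **NV: `ModLCuspLaws` holds at the UNORIENTED §1 model datum `udatum`** (all six laws, every admissible `l`):
the laws (L0)–(L4) do not see the orientation of the zero cusp. ([IUTchI] §1 pp.37–38)
[claim: Mochizuki2012, status: disputed] -/
theorem modLCuspLaws_udatum (h5 : 5 ≤ l) (h6 : Nat.Coprime l 6) : (udatum l h5 h6).ModLCuspLaws := by
  haveI : NeZero l := ⟨by omega⟩
  have h3 : 3 ≤ l := by omega
  obtain ⟨q, hq⟩ := odd_of_coprime_six h6
  refine ⟨?_, ?_, ?_, ?_, ?_, ?_⟩
  · -- (L0) `modLKer = 1`, `Δ_X̲ = N` finite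
    rw [udatum_modLKer, udatum_deltaXbar]
    exact relIndex_bot_Nhat_ne_zero
  · -- (L1) `I_x = D′_x = ⟨ĉ′_x⟩`
    intro x
    refine ⟨uhat l x, by rw [udatum_inertia]; exact uhat_mem_Du x, ?_⟩
    rw [udatum_inertia]
    exact Subgroup.le_topologicalClosure (G := (udatum l h5 h6).PiC) (Subgroup.zpowers (uhat l x))
  · -- (L2a)
    change (udatum l h5 h6).deltaEpsKer.relIndex
      ((udatum l h5 h6).inertia 1 ⊔ (udatum l h5 h6).deltaEpsKer) = l
    rw [udatum_deltaEpsKer, udatum_inertia]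
    exact relIndex_EpsSupU_Du_one_sup h3
  · -- (L2c)
    change (udatum l h5 h6).inertia 1 ⊓ ((udatum l h5 h6).inertia (-1) ⊔ (udatum l h5 h6).deltaEpsKer) ≤
      (udatum l h5 h6).deltaEpsKer
    rw [udatum_inertia, udatum_inertia, udatum_deltaEpsKer]
    exact Du_one_inf_sup_le h5
  · -- (L3)
    intro c hc hcX v hv
    change c ∈ (udatum l h5 h6).DeltaCbar at hc
    change c ∉ (udatum l h5 h6).DeltaXbar at hcX
    change v ∈ (udatum l h5 h6).DeltaXbar at hv
    change c * v * c⁻¹ * v ∈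
      (udatum l h5 h6).inertia 1 ⊔ (udatum l h5 h6).inertia (-1) ⊔ (udatum l h5 h6).deltaEpsKer
    rw [udatum_deltaCbar] at hc
    rw [udatum_deltaXbar] at hcX hv
    rw [udatum_inertia, udatum_inertia, udatum_deltaEpsKer]
    exact conj_mul_self_mem_supU h3 hq hc hcX hv
  · -- (L4)
    intro x g hg z hz
    change g ∈ (udatum l h5 h6).PiXbar at hg
    change z ∈ (udatum l h5 h6).inertia x at hz
    rw [udatum_piXbar] at hg
    rw [udatum_inertia] at hz
    rw [udatum_modLKer, Subgroup.mem_bot]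
    exact conj_mul_inv_eq_one_of_mem_Du hg hz

/-- A geometric representative of `Gal(X̲/C̲)` in the unoriented model: `ŝ = (0, σ_0) ∈ Δ_C̲ ∖ Δ_X̲`.
[claim: Mochizuki2012, status: disputed] -/
theorem udatum_exists_iota (h5 : 5 ≤ l) (h6 : Nat.Coprime l 6) :
    ∃ c ∈ (udatum l h5 h6).DeltaCbar, c ∉ (udatum l h5 h6).DeltaXbar := by
  refine ⟨sigmaHat l, ?_, ?_⟩
  · change sigmaHat l ∈ (udatum l h5 h6).DeltaCbar
    rw [udatum_deltaCbar]; exact sigmaHat_mem_PiCbarm l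
  · change sigmaHat l ∉ (udatum l h5 h6).DeltaXbar
    rw [udatum_deltaXbar]; exact sigmaHat_not_mem_Nhat l

/-- **Consequence (the «hA re-grounding» fires at the unoriented model)**: `ArrowCoveringClaims (udatum l h5 h6)`
RE-DERIVED from the cusp action `udatumCuspGalois` (p437242), the six laws `modLCuspLaws_udatum`, and `ŝ`, via
`CuspGalois.arrowCoveringClaims_of_modLCuspLaws` (p448117); cf. the direct proof `udatum_arrowCoveringClaims`.
([IUTchI] §1 p.38) [claim: Mochizuki2012, status: disputed] -/
theorem udatum_arrowCoveringClaims_of_laws (h5 : 5 ≤ l) (h6 : Nat.Coprime l 6) :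
    (udatum l h5 h6).ArrowCoveringClaims :=
  (udatumCuspGalois h5 h6).arrowCoveringClaims_of_modLCuspLaws (modLCuspLaws_udatum h5 h6)
    (udatum_exists_iota h5 h6)

end ArrowModel

end PuncturedEllipticData

end Literature.IUT.HodgeTheaters
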